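import Summits.QuantumFields.BalabanUV.T4Continuum.Support.B13TermData
import Summits.QuantumFields.BalabanUV.T4Continuum.Support.ActivityTermDatumOnSub

/-!
# NE5 ∕ U3 — REPAIR R-b OF GAPS G-ne5p2-5, part 2: THE MEASURABLE OPERATOR SLOT `measOp` (the ℂ-submodule of `OpDatum (Species …)` of data
# whose `x`-sections on the potential species are measurable) and the measurability of the operator exponent of the term data of record ON IT

Cell `pub-balaban`, unit `b2b-balaban-t4-ne5-p2` (NE5 ∕ U3 PROVER seat P2, lineage gen 19).  Summits-side new work (cell bookkeeping over row O1-b's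
`OpDatum`∕`Species` and leaf-08's `TermCore.toTermDatum`; NOT a Literature module; nothing of the manuscripts is asserted).  HONEST FRAMING: rung (B)+1 of
the FINITE-VOLUME T⁴ programme — NOT infinite volume, NOT mass gap, NOT Clay, NOT NE5.

WHY.  G-ne5p2-5 (`B13TermDataOpMeasurability`, p214031): on the full slot `OpDatum (Species T κ ι Ω 𝒴) = ℓ^∞(Species)` K6's `Geometry.hopm` is false for
every core with a history label over a non-discrete `Ω`, because the potential species `potQ x …`∕`potR x Y` are indexed by the integration point and an
arbitrary bounded family need not have measurable `x`-sections.  Repair R-b keeps row O1-b's typing and RESTRICTS the slot: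
* §1 **`measOp : Submodule ℂ (OpDatum (Species T κ ι Ω 𝒴))`** — the data `o` with `x ↦ o(.potQ x Y b b')` and `x ↦ o(.potR x Y)` measurable for all
  labels (a ℂ-submodule: sums, scalar multiples, `0`); it inherits the sup norm (`Submodule.normedAddCommGroup`∕`normedSpace`), so K2∕K6 apply to it
  verbatim; `assemble_mem_measOp`: a raw kernel with measurable `x`-sections on the potential species, packaged against a format whose potential
  weights are measurable in `x` (e.g. `x`-independent, as the B13 format `B13Weights.format`), lies in `measOp` — the ONE-RUN side condition under which
  the operator data of record `opOf F raw` lie in the restricted slot (printed KIND: the (2.19) kernels are functions of the field configuration);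
* §2 **`measurable_opForm`**: for a term core with measurable Gaussian coordinates `Xf`, `Bf` and such a format, the operator exponent
  `x ↦ opForm o x` of leaf-08's term datum of record is MEASURABLE for every `o ∈ measOp`; hence **`geometry_onSub_measOp`**: the term datum of record
  RESTRICTED to `measOp` (`TermDatum.onSub`, part 1) HAS K6's `Geometry` as soon as its LATTICE part `GeometryCore` holds — the field `hopm` is PROVED
  (this file) and `hhistm` is leaf-08's `histm_toTermDatum`.  This is the non-vacuous replacement of the binder certified unsatisfiable in G-ne5p2-5;
* §3 `readLip_of_linear_signs` ∕ **`readLip_toTermDatum_signs`**: route P2's `ReadLip` for a term of record in the B13 format of its own weights from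
  the format letters ALONE (A4's `readLip_of_linear` ∕ leaf-08's `readLip_toTermDatum` used `Geometry` only through three weight signs, which the
  B13 weights' positivity supplies) — so `ReadLip`, too, needs no `Geometry`.
0 sorry; axioms ⊆ {propext, Classical.choice, Quot.sound}.
-/

noncomputable section

open MeasureTheory
open scoped BigOperators

namespace Summit.QuantumFields.BalabanUV.T4Continuum.B13OpMeasurable

open Literature.MathematicalPhysics.QuantumFieldTheory.Balaban1983to89
open Literature.MathematicalPhysics.QuantumFieldTheory.Balaban1983to89.T4OutputRate (Carriers)
open Literature.MathematicalPhysics.QuantumFieldTheory.Balaban1983to89.T4ActivityTilt (diffForm sandwichKer mulKer)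
open Literature.MathematicalPhysics.QuantumFieldTheory.Balaban1983to89.T4ActivityTiltPotential (potSum quadPart)
open Literature.MathematicalPhysics.QuantumFieldTheory.Balaban1983to89.T4ActivityTiltHistory (ReadAdditive ReadUnitBound)
open Summit.QuantumFields.BalabanUV.T4Continuum.ActivityTermModel (TermDatum TermConsts)
open Summit.QuantumFields.BalabanUV.T4Continuum.ActivityTermReadouts (LinearReadouts)
open Summit.QuantumFields.BalabanUV.T4Continuum.B13HistDatum (level136)
open Summit.QuantumFields.BalabanUV.T4Continuum.B13OpDatum (Format OpDatum entry assemble assemble_apply Species B13Weights FormatBounded)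
open Summit.QuantumFields.BalabanUV.T4Continuum.B13HistMeasurable (MeasPotFrame B13HistM)
open Summit.QuantumFields.BalabanUV.T4Continuum.B13TermData (TermCore)

/-! ## §1 The measurable operator slot -/

section Slot

variable (T κ ι Ω 𝒴 : Type*) [MeasurableSpace Ω]

/-- [folklore] **THE MEASURABLE OPERATOR SLOT**: the ℂ-submodule of `OpDatum (Species T κ ι Ω 𝒴)` of the operator data whose `x`-sections on the two
potential species are measurable — `x ↦ o(.potQ x Y b b')` and `x ↦ o(.potR x Y)` for all labels.  (The three Gaussian species are not indexed by `x`.) -/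
def measOp : Submodule ℂ (OpDatum (Species T κ ι Ω 𝒴)) where
  carrier := {o | (∀ (Y : 𝒴) (b b' : κ), Measurable fun x : Ω => (o : Species T κ ι Ω 𝒴 → ℂ) (.potQ x Y b b')) ∧
    ∀ Y : 𝒴, Measurable fun x : Ω => (o : Species T κ ι Ω 𝒴 → ℂ) (.potR x Y)}
  add_mem' {o o'} ho ho' := by
    refine ⟨fun Y b b' => ?_, fun Y => ?_⟩
    · have h := (ho.1 Y b b').add (ho'.1 Y b b')
      simpa only [lp.coeFn_add, Pi.add_apply, Pi.add_def] using h
    · have h := (ho.2 Y).add (ho'.2 Y)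
      simpa only [lp.coeFn_add, Pi.add_apply, Pi.add_def] using h
  zero_mem' := by
    refine ⟨fun Y b b' => ?_, fun Y => ?_⟩ <;> simp only [lp.coeFn_zero, Pi.zero_apply, measurable_const]
  smul_mem' c {o} ho := by
    refine ⟨fun Y b b' => ?_, fun Y => ?_⟩
    · have h := (ho.1 Y b b').const_smul c
      simpa only [lp.coeFn_smul, Pi.smul_apply, Pi.smul_def] using h
    · have h := (ho.2 Y).const_smul c
      simpa only [lp.coeFn_smul, Pi.smul_apply, Pi.smul_def] using h

variable {T κ ι Ω 𝒴}

/-- [folklore] Membership in the measurable slot, unfolded. -/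
theorem mem_measOp {o : OpDatum (Species T κ ι Ω 𝒴)} :
    o ∈ measOp T κ ι Ω 𝒴 ↔ (∀ (Y : 𝒴) (b b' : κ), Measurable fun x : Ω => (o : Species T κ ι Ω 𝒴 → ℂ) (.potQ x Y b b')) ∧
      ∀ Y : 𝒴, Measurable fun x : Ω => (o : Species T κ ι Ω 𝒴 → ℂ) (.potR x Y) :=
  Iff.rfl

/-- [folklore] **THE DATA OF RECORD LIE IN THE MEASURABLE SLOT** when the raw species have measurable `x`-sections on the potential species and the
format's potential weights are measurable in `x` (one-run side conditions of printed KIND; for an `x`-independent format the second is `measurable_const`). -/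
theorem assemble_mem_measOp (F : Format (Species T κ ι Ω 𝒴)) {K : Species T κ ι Ω 𝒴 → ℂ} (hK : FormatBounded F K)
    (hKQ : ∀ (Y : 𝒴) (b b' : κ), Measurable fun x : Ω => K (.potQ x Y b b')) (hKR : ∀ Y : 𝒴, Measurable fun x : Ω => K (.potR x Y))
    (hFQ : ∀ (Y : 𝒴) (b b' : κ), Measurable fun x : Ω => F.wt (.potQ x Y b b')) (hFR : ∀ Y : 𝒴, Measurable fun x : Ω => F.wt (.potR x Y)) :
    assemble F K ∈ measOp T κ ι Ω 𝒴 := by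
  refine ⟨fun Y b b' => ?_, fun Y => ?_⟩
  · have h : Measurable fun x : Ω => K (.potQ x Y b b') / (F.wt (.potQ x Y b b') : ℂ) :=
      (hKQ Y b b').div (Complex.measurable_ofReal.comp (hFQ Y b b'))
    have e : (fun x : Ω => (assemble F K : Species T κ ι Ω 𝒴 → ℂ) (.potQ x Y b b')) =
        fun x => K (.potQ x Y b b') / (F.wt (.potQ x Y b b') : ℂ) := funext fun x => assemble_apply hK _
    rw [e]
    exact h
  · have h : Measurable fun x : Ω => K (.potR x Y) / (F.wt (.potR x Y) : ℂ) :=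
      (hKR Y).div (Complex.measurable_ofReal.comp (hFR Y))
    have e : (fun x : Ω => (assemble F K : Species T κ ι Ω 𝒴 → ℂ) (.potR x Y)) = fun x => K (.potR x Y) / (F.wt (.potR x Y) : ℂ) :=
      funext fun x => assemble_apply hK _
    rw [e]
    exact h

end Slot

/-! ## §2 The operator exponent of the term data of record is measurable on the measurable slot -/

section Exponent

variable {C : Carriers} {P : MeasPotFrame C} {𝒴 : Type*} {dom : 𝒴 → C.Dom} {T κ ι Ω Ω₀ 𝒞 S : Type*} [MeasurableSpace Ω]
  [MeasurableSpace Ω₀] [Fintype ι] [Fintype κ] [DecidableEq ι] [DecidableEq κ]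
  (𝔠 : TermCore P dom T κ ι Ω Ω₀ 𝒞) (F : Format (Species T κ ι Ω 𝒴)) (G : B13Weights κ ι S 𝒴) (ϱ : ℝ)

/-- [folklore] **THE OPERATOR EXPONENT IS MEASURABLE ON THE MEASURABLE SLOT.**  For a core whose Gaussian coordinates `x ↦ Xf x i`, `x ↦ Bf x a`
are measurable and a format whose potential weights are measurable in `x`, every `o ∈ measOp` has a measurable operator exponent
`x ↦ opForm o x` (a finite sum of products of measurable coordinate functions with the `x`-independent Gaussian kernel entries and the measurable
potential read-outs). -/
theorem measurable_opForm (hXf : ∀ i, Measurable fun x => 𝔠.Xf x i) (hBf : ∀ a, Measurable fun x => 𝔠.Bf x a)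
    (hFQ : ∀ (Y : 𝒴) (b b' : κ), Measurable fun x : Ω => F.wt (.potQ x Y b b')) (hFR : ∀ Y : 𝒴, Measurable fun x : Ω => F.wt (.potR x Y))
    (o : measOp T κ ι Ω 𝒴) : Measurable fun x => (𝔠.toTermDatum F G ϱ).opForm o.1 x := by
  have hX : ∀ b, Measurable fun x => (((𝔠.toTermDatum F G ϱ).Xf x b : ℝ) : ℂ) := fun b => Complex.measurable_ofReal.comp (hXf b)
  have hB : ∀ a, Measurable fun x => (((𝔠.toTermDatum F G ϱ).Bf x a : ℝ) : ℂ) := fun a => Complex.measurable_ofReal.comp (hBf a)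
  have hQ : ∀ Y b b', Measurable fun x => (𝔠.toTermDatum F G ϱ).kQ o.1 x Y b b' := fun Y b b' => by
    have h : Measurable fun x => (F.wt (.potQ x Y b b') : ℂ) * (o.1 : Species T κ ι Ω 𝒴 → ℂ) (.potQ x Y b b') :=
      (Complex.measurable_ofReal.comp (hFQ Y b b')).mul (o.2.1 Y b b')
    exact h
  have hR : ∀ Y, Measurable fun x => (𝔠.toTermDatum F G ϱ).kR o.1 x Y := fun Y => by
    have h : Measurable fun x => (F.wt (.potR x Y) : ℂ) * (o.1 : Species T κ ι Ω 𝒴 → ℂ) (.potR x Y) :=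
      (Complex.measurable_ofReal.comp (hFR Y)).mul (o.2.2 Y)
    exact h
  have h1 : Measurable fun x => diffForm ((𝔠.toTermDatum F G ϱ).R₁ o.1) ((𝔠.toTermDatum F G ϱ).kP o.1) ((𝔠.toTermDatum F G ϱ).Γ o.1)
      ((𝔠.toTermDatum F G ϱ).Xf x) ((𝔠.toTermDatum F G ϱ).Bf x) := by
    unfold diffForm
    refine ((Measurable.const_mul (Finset.measurable_sum _ fun b _ => Finset.measurable_sum _ fun b' _ => ?_) _).add
      (Measurable.const_mul (Finset.measurable_sum _ fun a _ => Finset.measurable_sum _ fun a' _ => ?_) _)).add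
      (Finset.measurable_sum _ fun a _ => Finset.measurable_sum _ fun b _ => ?_)
    · exact ((hX b).mul_const _).mul (hX b')
    · exact ((hB a).mul_const _).mul (hB a')
    · exact ((hB a).mul_const _).mul (hX b)
  have h2 : Measurable fun x => potSum (𝔠.toTermDatum F G ϱ).D (𝔠.toTermDatum F G ϱ).bonds (𝔠.toTermDatum F G ϱ).τ
      ((𝔠.toTermDatum F G ϱ).kQ o.1 x) ((𝔠.toTermDatum F G ϱ).kR o.1 x) ((𝔠.toTermDatum F G ϱ).Bf x) := by
    unfold potSum quadPart
    refine Finset.measurable_sum _ fun Y _ => Measurable.const_mul (Measurable.add ?_ (hR Y)) _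
    refine Measurable.const_mul (Finset.measurable_sum _ fun b _ => Finset.measurable_sum _ fun b' _ => ?_) _
    exact ((hB b).mul (hQ Y b b')).mul (hB b')
  exact h1.add h2

variable [DecidableEq 𝒞]

/-- [folklore] **K6's `Geometry` FOR THE TERM DATUM OF RECORD RESTRICTED TO THE MEASURABLE SLOT** from its LATTICE part (`GeometryCore`: pseudo-metric,
site sums, weights, pins, input-free measurabilities — printed KIND, satisfiable), measurable Gaussian coordinates of the core and a format with
measurable potential weights: `hopm` is `measurable_opForm`, `hhistm` is leaf-08's `histm_toTermDatum`.  The non-vacuous replacement of the binder of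
G-ne5p2-5. -/
theorem geometry_onSub_measOp {𝔡 : TermConsts} (hcore : (𝔠.toTermDatum F G ϱ).GeometryCore 𝔡)
    (hXf : ∀ i, Measurable fun x => 𝔠.Xf x i) (hBf : ∀ a, Measurable fun x => 𝔠.Bf x a)
    (hFQ : ∀ (Y : 𝒴) (b b' : κ), Measurable fun x : Ω => F.wt (.potQ x Y b b')) (hFR : ∀ Y : 𝒴, Measurable fun x : Ω => F.wt (.potR x Y)) :
    ((𝔠.toTermDatum F G ϱ).onSub (measOp T κ ι Ω 𝒴)).Geometry 𝔡 :=
  (𝔠.toTermDatum F G ϱ).geometry_onSub 𝔡 (measOp T κ ι Ω 𝒴) hcore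
    (fun o => (measurable_opForm 𝔠 F G ϱ hXf hBf hFQ hFR o).aestronglyMeasurable) fun y => 𝔠.histm_toTermDatum F G ϱ y

end Exponent

/-! ## §3 `ReadLip` for the term data of record WITHOUT the geometry binder (the B13 format of the step's own weights) -/

section ReadLipCore

variable {Op Hist ι κ S Ω Ω₀ 𝒴 𝒞 : Type*} [Fintype ι] [Fintype κ] [MeasurableSpace Ω] [MeasurableSpace Ω₀]
  [NormedAddCommGroup Op] [NormedSpace ℂ Op] [NormedAddCommGroup Hist] [NormedSpace ℂ Hist]
  {ℒ : LinearReadouts Op ι κ Ω 𝒴} {𝔱 : TermDatum Op Hist ι κ S Ω Ω₀ 𝒴 𝒞} {𝔠 : TermConsts}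

omit [Fintype ι] [Fintype κ] [NormedSpace ℂ Hist] in
/-- [folklore] **`ReadLip` BY CONSTRUCTION for linearly-read operator data, from the SIGNS of the potential weights only** — this lineage's
`ActivityTermReadouts.readLip_of_linear` (A4) with its `Geometry` hypothesis (used there only through `hw`∕`hk`∕`hv`) replaced by the three sign
conditions, so that no `Geometry` (G-ne5p2-5) is needed to produce `ReadLip`. -/
theorem readLip_of_linear_signs [DecidableEq ι] [DecidableEq κ] {lamL lamA lamP lamQ lamR ϱOp ϱHist : ℝ}
    (hread : ℒ.Reads 𝔱) (hcal : ℒ.Calibrated 𝔱 𝔠 lamL lamA lamP lamQ lamR) (hw : ∀ Y ∈ 𝔱.D, 0 ≤ 𝔱.w Y) (hk : ∀ b b', 0 ≤ 𝔱.kk b b')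
    (hv : ∀ Y ∈ 𝔱.D, 0 ≤ 𝔱.v Y) (hϱ : 0 < ϱOp)
    (hκL : ϱOp * lamL ≤ 𝔠.κL) (hκA : ϱOp * lamA ≤ 𝔠.κA) (hκP : ϱOp * lamP ≤ 𝔠.κP) (hκQ : ϱOp * lamQ ≤ 𝔠.κQ)
    (hκR : ϱOp * lamR ≤ 𝔠.κR) (hadd : ReadAdditive 𝔱.read) (hunit : ReadUnitBound 𝔱.read 𝔱.D 𝔱.τ 𝔱.v ϱHist) :
    𝔱.ReadLip 𝔠 ϱOp ϱHist where
  hkL o o' a' i := by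
    rw [hread.hL o, hread.hL o']
    exact (ActivityTermReadouts.norm_clm_sub_le _ hϱ (hcal.hL a' i) o o').trans
      (mul_le_mul_of_nonneg_right (mul_le_mul_of_nonneg_right hκL (div_nonneg (norm_nonneg _) hϱ.le)) (Real.exp_pos _).le)
  hkA o o' i j := by
    rw [hread.hA o, hread.hA o']
    exact (ActivityTermReadouts.norm_clm_sub_le _ hϱ (hcal.hA i j) o o').trans
      (mul_le_mul_of_nonneg_right (mul_le_mul_of_nonneg_right hκA (div_nonneg (norm_nonneg _) hϱ.le)) (Real.exp_pos _).le)
  hkP o o' a' a'' := by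
    rw [hread.hP o, hread.hP o']
    exact (ActivityTermReadouts.norm_clm_sub_le _ hϱ (hcal.hP a' a'') o o').trans
      (mul_le_mul_of_nonneg_right (mul_le_mul_of_nonneg_right hκP (div_nonneg (norm_nonneg _) hϱ.le)) (Real.exp_pos _).le)
  hkQ o o' x Y hY b hb b' hb' := by
    rw [hread.hQ o, hread.hQ o']
    exact (ActivityTermReadouts.norm_mul_clm_sub_le _ _ hϱ (hcal.hQ x Y hY b hb b' hb') o o').trans
      (mul_le_mul_of_nonneg_right (mul_le_mul_of_nonneg_right hκQ (div_nonneg (norm_nonneg _) hϱ.le))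
        (mul_nonneg (hw Y hY) (hk b b')))
  hkR o o' x Y hY := by
    rw [hread.hR o, hread.hR o']
    exact (ActivityTermReadouts.norm_mul_clm_sub_le _ _ hϱ (hcal.hR x Y hY) o o').trans
      (mul_le_mul_of_nonneg_right (mul_le_mul_of_nonneg_right hκR (div_nonneg (norm_nonneg _) hϱ.le)) (hv Y hY))
  hadd := hadd
  hunit := hunit

end ReadLipCore

section ReadLipRecord

variable {C : Carriers} {P : MeasPotFrame C} {𝒴 : Type*} {dom : 𝒴 → C.Dom} {T κ ι Ω Ω₀ 𝒞 S : Type*} [MeasurableSpace Ω]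
  [MeasurableSpace Ω₀] [Fintype ι] [Fintype κ] [DecidableEq ι] [DecidableEq κ]
  (𝔠 : TermCore P dom T κ ι Ω Ω₀ 𝒞) (G : B13Weights κ ι S 𝒴) (ϱ : ℝ)

omit [Fintype ι] [Fintype κ] in
/-- [folklore] **ROUTE P2's `ReadLip` FOR A TERM OF RECORD IN THE B13 FORMAT OF ITS OWN WEIGHTS — WITH NO GEOMETRY BINDER** (leaf-08's
`TermCore.readLip_toTermDatum` with its `Geometry` hypothesis removed: the signs it used are the B13 weights' positivity and `ϱ ≥ 0`).  Inputs:
the format equality `G.δ = 𝔡.δ`, ONE `𝐕″`-format domination `G.v ≤ λR·(ϱ·‖τ‖·level136)` on the core's labels, and the margin inequalities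
`0 < ϱOp ≤ κL, κA, κP, κQ`, `ϱOp·λR ≤ κR`, `ϱ > 0` — inequalities among the instancer's own letters. -/
theorem readLip_toTermDatum_signs (𝔡 : TermConsts) (hδ : G.δ = 𝔡.δ) {lamR ϱOp : ℝ}
    (hvR : ∀ Y ∈ 𝔠.D, G.v Y ≤ lamR * (ϱ * (‖G.τ Y‖ * level136 P.consts (C.d (dom Y)))))
    (hϱOp : 0 < ϱOp) (hϱ : 0 < ϱ) (hκL : ϱOp ≤ 𝔡.κL) (hκA : ϱOp ≤ 𝔡.κA) (hκP : ϱOp ≤ 𝔡.κP) (hκQ : ϱOp ≤ 𝔡.κQ)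
    (hκR : ϱOp * lamR ≤ 𝔡.κR) :
    (𝔠.toTermDatum G.format G ϱ).ReadLip 𝔡 ϱOp ϱ :=
  readLip_of_linear_signs (𝔠.reads_toTermDatum _ G ϱ) (𝔠.calibrated_toTermDatum 𝔡 hδ hvR) (fun Y _ => (G.w_pos Y).le)
    (fun b b' => (G.kk_pos b b').le) (fun Y _ => 𝔠.v_nonneg_toTermDatum _ _ hϱ.le Y) hϱOp
    (by rw [mul_one]; exact hκL) (by rw [mul_one]; exact hκA) (by rw [mul_one]; exact hκP) (by rw [mul_one]; exact hκQ) hκR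
    (𝔠.readAdditive_toTermDatum _ G ϱ) (𝔠.readUnitBound_toTermDatum _ G hϱ)

end ReadLipRecord

end Summit.QuantumFields.BalabanUV.T4Continuum.B13OpMeasurable

end
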